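/-
Copyright: the b2b-balaban T⁴-continuum CRUX team, row NE7b owner lineage `t4-ne7b-p1` (gen 114). Project licence.
-/
import Summits.QuantumFields.BalabanUV.T4Continuum.Spine.NE7b.HardStepChartRadius
import Summits.QuantumFields.BalabanUV.T4Continuum.Spine.NE7b.HardStepBranchDeriv
import Mathlib.Analysis.Normed.Lp.lpSpace
import Mathlib.Analysis.Calculus.Deriv.Shift

/-!
# LOCAL INTERACTIONS ACT ON `ℓ^∞` AS `C¹` NEMYTSKII MAPS WITH THE SMALL-FIELD LETTER, AND THE SMALL-FIELD BACKGROUND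
# CONFIGURATION FOLLOWS IN THE SUP CURRENCY: for `u : ℝ → ℝ` with `|u′| ≤ λ` and `u′` `L`-Lipschitz, `φ ↦ u ∘ φ` maps `ℓ^∞(ι)`
# to itself, is differentiable EVERYWHERE with derivative the multiplication operator by `u′ ∘ φ` (norm `≤ λ`), and
# `‖DN(φ) − DN(ψ)‖ ≤ L‖φ − ψ‖_∞`; so for ANY chart `T : ℓ^∞ ≃L F × K` reading `(Q, R)` with `‖T⁻¹y‖ ≤ N‖y‖` and any `P : ℓ^∞ →L K`
# with `‖P‖·λ < N⁻¹`, `u 0 = 0`: every coarse datum `‖w‖ ≤ (N⁻¹ − ‖P‖λ)·r` has EXACTLY ONE fine field `φ`, `‖φ‖_∞ ≤ r`, with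
# `Qφ = w` and `Rφ + P(u ∘ φ) = 0`, `(N⁻¹ − ‖P‖λ)⁻¹`-Lipschitz in `w`
# (row NE7b, node U5c; HSCR `exists_branch_chart` at `δ₀ = 0` fed by the Nemytskii letter; the chart `T` enters BY SHAPE — the owner's
# (56) `…AugmentedSectionFibreEquivalence` ∕ leaf-06's (57) `…AugmentedSupEquivalence` supply it for the Gaussian skeleton on `ℤ^d`;
# Mathlib + HSCR only; [folklore])

Cell `pub-balaban`, sub-cell `t4`, spine estimate NE7b (`T4WeightBudget.RelWeightBound`; the cell's OWN estimate — NOT PRINTED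
in [Bałaban 1983–89], NOT PROVED).  Crux-route work under `Spine/NE7b/` by the row OWNER (`t4-ne7b-p1` gen 114) under FREEZE
(0)'s crux-prover clause (FILING-CLAIMS C-ne7bp1-g114-4 ∕ -5); NOTHING of Bałaban's is named as a Lean object, valued or asserted; no
`T4Continuum/Support` leaf typed; no `def`, no notation (maps are produced as `∃` with their pointwise action); zero `sorry`.  Imports:
this row's `…HardStepChartRadius` (HSCR) and (v1.1) `…HardStepBranchDeriv` (HSBD) (leaf-03; Mathlib only behind them) and Mathlib's `lp`.  `ι` is ANY index type (the lattice
`ℤ^d`, a torus, a block) and `ℓ^∞ := lp (fun _ : ι => ℝ) ∞` in prose.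

WHY (located).  The hard-step road reads the interacting action through two smallness letters: HSCR's `hgc : ‖Dg(x) − g′‖ ≤ c` on the
chart ball (equivalently HSIS's `hVc : ‖V″x − V″δ₀‖ ≤ c`), with `c < N⁻¹` against the chart constant `N`.  Print's small-field
regions are SUP-norm balls (`…HardStepRadiusSupNorm`: in `ℓ^∞` the radius letter is a condition, in `ℓ²` an impossibility), and the
interaction is LOCAL: `V(φ) = ½⟨φ, Aφ⟩ + Σ_x v(φ(x))`.  On `ℓ^∞` such a `V` is not even finite, but its Euler–Lagrange map is:
`φ ↦ Aφ + v′ ∘ φ`, sitewise.  This file types the one analytic fact that makes the sitewise term harmless in the sup currency — the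
superposition (Nemytskii) map `φ ↦ u ∘ φ` (`u = v′`) is `C¹` on `ℓ^∞` with derivative `h ↦ (u′ ∘ φ)·h` and the Lipschitz letter
`‖DN(φ) − DN(ψ)‖ ≤ Lip(u′)·‖φ − ψ‖_∞` (sitewise second-order Taylor by the mean-value inequality; NO dimension, NO volume factor — the
letter that fails in `ℓ²`, where `‖(u′∘φ − u′∘ψ)·h‖₂ ≤ L‖φ − ψ‖_∞‖h‖₂` needs the SUP distance anyway) — and then runs HSCR's
quantitative branch with it: given the free chart `T` of the quadratic part in the form (56)∕(57) deliver (`T h = (Q h, R h)`,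
`‖T⁻¹ y‖ ≤ N‖y‖`; for the Gaussian skeleton on `ℤ^d`: `Q = Q′`, `R = A − Q′*Q′A` into `ker Q′`, `N = N_∞` mesh-uniform) and the
projection `P` onto the transversal directions, the constrained Euler–Lagrange equation `Rφ + P(u ∘ φ) = 0`, `Qφ = w` has a unique
small solution, Lipschitz in the coarse field — the background configuration of the perturbed Gaussian model in the currency of
print's small-field conditions, with the smallness condition `‖P‖·sup|v″| < N⁻¹` and NO restriction on the radius.

WHAT IS PROVED ([folklore]; `E := lp (fun _ : ι => ℝ) ∞`):
* §1 `abs_apply_le_norm`, `exists_clm_of_letters` (a pointwise-defined additive homogeneous bounded map on `ℓ^∞(ι)` is a bounded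
  operator), **`exists_clm_mul`** (multiplication by a bounded field `g`, `|g| ≤ λ`: an operator of norm `≤ λ`).
* §2 `abs_taylor_two` (`|u(a + b) − u(a) − u′(a)b| ≤ L·b²` for `u′` `L`-Lipschitz), `abs_comp_le` (`|u(t)| ≤ |u 0| + λ|t|`),
  **`exists_nemytskii`** — `∃ N : E → E, N′ : E → (E →L E)` with `N φ i = u (φ i)`, `N′ φ h i = u′(φ i)·h i`, `HasFDerivAt N (N′ φ) φ`
  for EVERY `φ`, `‖N′ φ‖ ≤ λ`, **`‖N′ φ − N′ ψ‖ ≤ L‖φ − ψ‖`**.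
* §3 `hasFDerivAt_transversal`, **`norm_fderiv_transversal_sub_le`** — for `g φ := R φ + P (N φ)`: `Dg(φ) = R + P ∘ N′φ` and
  `‖Dg(φ) − R‖ ≤ ‖P‖·λ` EVERYWHERE (HSCR's `hgc` with a radius-free `c`).
* §4 **`exists_smallField_branch`** (`ι` nonempty; `E` is complete and nontrivial): `T : E ≃L F × K` with `T h = (Q h, R h)`,
  `‖T⁻¹y‖ ≤ N‖y‖`; `u 0 = 0`; `c := C_P·λ < N⁻¹` (`‖P‖ ≤ C_P`) ⟹ for every `r ≥ 0` a map `σ : F → E` with `σ 0 = 0`, and for all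
  `w ∈ closedBall 0 ((N⁻¹ − c)r)`: `‖σ w‖ ≤ r`, `Q(σ w) = w`, `R(σ w) + P(N(σ w)) = 0`; `σ` is `(N⁻¹ − c)⁻¹`-Lipschitz there; and every
  `φ` with `‖φ‖ ≤ r` solving the equation is `σ (Qφ)` (uniqueness) — HSCR `exists_branch_chart` at `δ₀ = 0`.
* §5 toy.
* §6 (v1.1, APPEND) **`exists_smallField_branch_deriv`** — §4's branch with its DERIVATIVE: at every interior `‖w‖ < (N⁻¹ − c)r` the
  background configuration is differentiable, `‖Dσ(w)‖ ≤ (N⁻¹ − c)⁻¹` and `Q ∘ Dσ(w) = 1` (`…HardStepBranchDeriv`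
  `hasFDerivAt_sliceBranch_of_chart` ∕ `fst_comp_symm_comp_inl` BY NAME; the linearisation `(Q, R + P∘N′φ)` is within `‖P‖λ` of `T`).

NOT HERE (honest): the chart `T` itself ((56) abstract; (57)∕ASE for the Gaussian skeleton on `ℤ^d` — leaf-06's C-ne7bleaf06g160-2);
local perturbations with only LOCALLY bounded `v″`, `v‴` (then `λ`, `L` are read on the ball and `c` depends on `r` — same proof, not
typed); gauge-covariant actions ((A3), NC-NE7b-α UNRULED); anything of Bałaban's.  BY-NAME EFFECT ON THE WALL: NONE.  NE7b NOT PRINTED ∕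
NOT PROVED; spine PROVED 0∕9; rung (B)+1 on a FINITE torus — NOT infinite volume, NOT the mass gap, NOT Clay.  HONEST DEPENDENCY:
continuum YM on T⁴ ⇐ BetaPertH ∧ nine spine estimates (0∕9 proved); BetaPertH ⇐ (D1) ∧ (D4) ∧ CAP+tail; G-an2-4 gates asym, D1 and NE2∕3∕4.
-/

set_option autoImplicit false

noncomputable section

namespace Summit.QuantumFields.BalabanUV.T4Continuum.NE7b.LocalNemytskiiSup

open Set Metric Filter Topology Asymptotics
open scoped ENNReal NNReal

variable {ι : Type*}

/-! ## §1. Bounded fields: evaluation, pointwise-defined operators, multiplication operators -/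

/-- `|f i| ≤ ‖f‖` on `ℓ^∞(ι)`. [folklore] -/
theorem abs_apply_le_norm (f : lp (fun _ : ι => ℝ) ∞) (i : ι) : |f i| ≤ ‖f‖ := by
  have h := lp.norm_apply_le_norm ENNReal.top_ne_zero f i
  rwa [Real.norm_eq_abs] at h

/-- **A pointwise-defined, additive, homogeneous, bounded map on `ℓ^∞(ι)` is a bounded operator** with the same action and `‖T‖ ≤ C`.
[folklore] -/
theorem exists_clm_of_letters (Φ : (ι → ℝ) → ι → ℝ) {C : ℝ} (hC : 0 ≤ C)
    (hadd : ∀ (f g : lp (fun _ : ι => ℝ) ∞) (i : ι), Φ (⇑f + ⇑g) i = Φ f i + Φ g i)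
    (hsmul : ∀ (r : ℝ) (f : lp (fun _ : ι => ℝ) ∞) (i : ι), Φ (r • ⇑f) i = r * Φ f i)
    (hbd : ∀ (f : lp (fun _ : ι => ℝ) ∞) (i : ι), |Φ f i| ≤ C * ‖f‖) :
    ∃ T : lp (fun _ : ι => ℝ) ∞ →L[ℝ] lp (fun _ : ι => ℝ) ∞, (∀ (f : lp (fun _ : ι => ℝ) ∞) (i : ι), T f i = Φ f i) ∧ ‖T‖ ≤ C := by
  have hmem : ∀ f : lp (fun _ : ι => ℝ) ∞, Memℓp (Φ f) ∞ := fun f =>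
    memℓp_infty ⟨C * ‖f‖, by
      rintro _ ⟨i, rfl⟩
      dsimp only
      rw [Real.norm_eq_abs]
      exact hbd f i⟩
  let T₀ : lp (fun _ : ι => ℝ) ∞ → lp (fun _ : ι => ℝ) ∞ := fun f => ⟨Φ f, hmem f⟩
  have happ : ∀ (f : lp (fun _ : ι => ℝ) ∞) (i : ι), T₀ f i = Φ f i := fun f i => rfl
  have hadd' : ∀ f g : lp (fun _ : ι => ℝ) ∞, T₀ (f + g) = T₀ f + T₀ g := by
    intro f g
    refine lp.ext (funext fun i => ?_)
    rw [lp.coeFn_add, Pi.add_apply, happ, happ, happ, lp.coeFn_add]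
    exact hadd f g i
  have hsmul' : ∀ (r : ℝ) (f : lp (fun _ : ι => ℝ) ∞), T₀ (r • f) = r • T₀ f := by
    intro r f
    refine lp.ext (funext fun i => ?_)
    rw [lp.coeFn_smul, Pi.smul_apply, happ, happ, lp.coeFn_smul, smul_eq_mul]
    exact hsmul r f i
  let Tl : lp (fun _ : ι => ℝ) ∞ →ₗ[ℝ] lp (fun _ : ι => ℝ) ∞ := { toFun := T₀, map_add' := hadd', map_smul' := hsmul' }
  have hbd' : ∀ f : lp (fun _ : ι => ℝ) ∞, ‖Tl f‖ ≤ C * ‖f‖ := fun f =>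
    lp.norm_le_of_forall_le (mul_nonneg hC (norm_nonneg _)) fun i => by
      change ‖Φ f i‖ ≤ _
      rw [Real.norm_eq_abs]
      exact hbd f i
  exact ⟨Tl.mkContinuous _ hbd', fun f i => rfl, Tl.mkContinuous_norm_le hC hbd'⟩

/-- **MULTIPLICATION BY A BOUNDED FIELD** `g` (`|g i| ≤ λ`, `0 ≤ λ`) is a bounded operator on `ℓ^∞(ι)` of norm `≤ λ`:
`(M h)(i) = g(i)·h(i)`. [folklore] -/
theorem exists_clm_mul (g : ι → ℝ) {lam : ℝ} (hlam : 0 ≤ lam) (hg : ∀ i, |g i| ≤ lam) :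
    ∃ M : lp (fun _ : ι => ℝ) ∞ →L[ℝ] lp (fun _ : ι => ℝ) ∞, (∀ (h : lp (fun _ : ι => ℝ) ∞) (i : ι), M h i = g i * h i) ∧ ‖M‖ ≤ lam := by
  refine exists_clm_of_letters (fun f i => g i * f i) hlam (fun f f' i => ?_) (fun r f i => ?_) (fun f i => ?_)
  · rw [Pi.add_apply, mul_add]
  · rw [Pi.smul_apply, smul_eq_mul]; ring
  · rw [abs_mul]
    exact mul_le_mul (hg i) (abs_apply_le_norm f i) (abs_nonneg _) hlam

/-! ## §2. The Nemytskii map `φ ↦ u ∘ φ` on `ℓ^∞(ι)` -/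

/-- **SECOND-ORDER TAYLOR, SITEWISE**: if `u` has derivative `u′` everywhere and `u′` is `L`-Lipschitz, then
`|u(a + b) − u(a) − u′(a)·b| ≤ L·b²` (mean-value inequality for `t ↦ u(a + t) − u′(a)·t` on the segment). [folklore] -/
theorem abs_taylor_two {u u' : ℝ → ℝ} (hu : ∀ t, HasDerivAt u (u' t) t) {L : ℝ} (hL : ∀ s t, |u' s - u' t| ≤ L * |s - t|)
    (a b : ℝ) : |u (a + b) - u a - u' a * b| ≤ L * b ^ 2 := by
  -- the auxiliary function and its derivative on the segment `uIcc 0 b`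
  have hderiv : ∀ t ∈ uIcc (0 : ℝ) b,
      HasDerivWithinAt (fun t => u (a + t) - u' a * t) (u' (a + t) - u' a) (uIcc (0 : ℝ) b) t := by
    intro t _
    have h1 : HasDerivAt (fun t => u (a + t)) (u' (a + t)) t := HasDerivAt.comp_const_add a t (hu (a + t))
    have h2 : HasDerivAt (fun t => u' a * t) (u' a) t := by
      simpa using (hasDerivAt_id t).const_mul (u' a)
    exact (h1.sub h2).hasDerivWithinAt
  have hbound : ∀ t ∈ uIcc (0 : ℝ) b, ‖u' (a + t) - u' a‖ ≤ L * |b| := by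
    intro t ht
    rw [Real.norm_eq_abs]
    have h1 := hL (a + t) a
    rw [add_sub_cancel_left] at h1
    have ht' : |t| ≤ |b| := by
      rcases le_total 0 b with hb | hb
      · rw [uIcc_of_le hb] at ht
        rw [abs_of_nonneg ht.1, abs_of_nonneg hb]; exact ht.2
      · rw [uIcc_of_ge hb] at ht
        rw [abs_of_nonpos ht.2, abs_of_nonpos hb]; linarith [ht.1]
    have hL0 : 0 ≤ L := by
      have h2 : (0 : ℝ) ≤ L * |(1 : ℝ) - 0| := (abs_nonneg _).trans (hL 1 0)
      simpa using h2
    exact h1.trans (mul_le_mul_of_nonneg_left ht' hL0)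
  have h := Convex.norm_image_sub_le_of_norm_hasDerivWithin_le hderiv hbound (convex_uIcc 0 b) left_mem_uIcc right_mem_uIcc
  simp only [add_zero, mul_zero, sub_zero, Real.norm_eq_abs] at h
  calc |u (a + b) - u a - u' a * b| = |u (a + b) - u' a * b - u a| := by ring_nf
    _ ≤ L * |b| * |b| := h
    _ = L * b ^ 2 := by rw [mul_assoc, abs_mul_abs_self, sq]

/-- `|u t| ≤ |u 0| + λ·|t|` when `|u′| ≤ λ`. [folklore] -/
theorem abs_comp_le {u u' : ℝ → ℝ} (hu : ∀ t, HasDerivAt u (u' t) t) {lam : ℝ} (hlam : ∀ t, |u' t| ≤ lam) (t : ℝ) :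
    |u t| ≤ |u 0| + lam * |t| := by
  have hderiv : ∀ s ∈ uIcc (0 : ℝ) t, HasDerivWithinAt u (u' s) (uIcc (0 : ℝ) t) s := fun s _ => (hu s).hasDerivWithinAt
  have hbound : ∀ s ∈ uIcc (0 : ℝ) t, ‖u' s‖ ≤ lam := fun s _ => by rw [Real.norm_eq_abs]; exact hlam s
  have h := Convex.norm_image_sub_le_of_norm_hasDerivWithin_le hderiv hbound (convex_uIcc 0 t) left_mem_uIcc right_mem_uIcc
  rw [Real.norm_eq_abs, Real.norm_eq_abs, sub_zero] at h
  calc |u t| = |u 0 + (u t - u 0)| := by ring_nf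
    _ ≤ |u 0| + |u t - u 0| := abs_add_le _ _
    _ ≤ |u 0| + lam * |t| := add_le_add le_rfl h

/-- **THE NEMYTSKII MAP ON `ℓ^∞` IS `C¹` WITH THE SMALL-FIELD LETTER.**  `u : ℝ → ℝ` with derivative `u′` everywhere, `|u′| ≤ λ`,
`u′` `L`-Lipschitz ⟹ there are `N : ℓ^∞ → ℓ^∞` and `N′ : ℓ^∞ → (ℓ^∞ →L ℓ^∞)` with `N φ i = u (φ i)`, `N′ φ h i = u′(φ i)·h i`,
`HasFDerivAt N (N′ φ) φ` at EVERY `φ`, `‖N′ φ‖ ≤ λ`, and `‖N′ φ − N′ ψ‖ ≤ L·‖φ − ψ‖`. [folklore] -/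
theorem exists_nemytskii {u u' : ℝ → ℝ} (hu : ∀ t, HasDerivAt u (u' t) t) {lam L : ℝ} (hlam0 : 0 ≤ lam)
    (hlam : ∀ t, |u' t| ≤ lam) (hL0 : 0 ≤ L) (hL : ∀ s t, |u' s - u' t| ≤ L * |s - t|) :
    ∃ (N : lp (fun _ : ι => ℝ) ∞ → lp (fun _ : ι => ℝ) ∞)
      (N' : lp (fun _ : ι => ℝ) ∞ → (lp (fun _ : ι => ℝ) ∞ →L[ℝ] lp (fun _ : ι => ℝ) ∞)),
      (∀ (φ : lp (fun _ : ι => ℝ) ∞) (i : ι), N φ i = u (φ i)) ∧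
      (∀ (φ h : lp (fun _ : ι => ℝ) ∞) (i : ι), N' φ h i = u' (φ i) * h i) ∧
      (∀ φ : lp (fun _ : ι => ℝ) ∞, HasFDerivAt N (N' φ) φ) ∧
      (∀ φ : lp (fun _ : ι => ℝ) ∞, ‖N' φ‖ ≤ lam) ∧
      (∀ φ ψ : lp (fun _ : ι => ℝ) ∞, ‖N' φ - N' ψ‖ ≤ L * ‖φ - ψ‖) := by
  -- the map
  have hmem : ∀ φ : lp (fun _ : ι => ℝ) ∞, Memℓp (fun i => u (φ i)) ∞ := fun φ =>
    memℓp_infty ⟨|u 0| + lam * ‖φ‖, by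
      rintro _ ⟨i, rfl⟩
      dsimp only
      rw [Real.norm_eq_abs]
      exact (abs_comp_le hu hlam (φ i)).trans (add_le_add le_rfl (mul_le_mul_of_nonneg_left (abs_apply_le_norm φ i) hlam0))⟩
  obtain ⟨N, hN⟩ : ∃ N : lp (fun _ : ι => ℝ) ∞ → lp (fun _ : ι => ℝ) ∞, ∀ φ i, N φ i = u (φ i) :=
    ⟨fun φ => ⟨fun i => u (φ i), hmem φ⟩, fun φ i => rfl⟩
  -- the derivative family: multiplication by `u′ ∘ φ`
  choose N' hN' hN'norm using fun φ : lp (fun _ : ι => ℝ) ∞ => exists_clm_mul (fun i => u' (φ i)) hlam0 (fun i => hlam (φ i))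
  refine ⟨N, N', hN, hN', fun φ => ?_, hN'norm, fun φ ψ => ?_⟩
  · -- differentiability: the remainder is `≤ L‖h‖²`
    have hrem : ∀ h : lp (fun _ : ι => ℝ) ∞, ‖N (φ + h) - N φ - N' φ h‖ ≤ L * ‖h‖ ^ 2 := fun h =>
      lp.norm_le_of_forall_le (by positivity) fun i => by
        rw [lp.coeFn_sub, lp.coeFn_sub, Pi.sub_apply, Pi.sub_apply, hN, hN, hN', lp.coeFn_add, Pi.add_apply, Real.norm_eq_abs]
        exact (abs_taylor_two hu hL (φ i) (h i)).trans
          (mul_le_mul_of_nonneg_left (by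
            rw [← sq_abs]
            exact pow_le_pow_left₀ (abs_nonneg _) (abs_apply_le_norm h i) 2) hL0)
    rw [hasFDerivAt_iff_isLittleO_nhds_zero, isLittleO_iff]
    intro ε hε
    have hδ : 0 < ε / (L + 1) := div_pos hε (by linarith)
    filter_upwards [Metric.ball_mem_nhds (0 : lp (fun _ : ι => ℝ) ∞) hδ] with h hh
    rw [Metric.mem_ball, dist_zero_right] at hh
    calc ‖N (φ + h) - N φ - N' φ h‖ ≤ L * ‖h‖ ^ 2 := hrem h
      _ = (L * ‖h‖) * ‖h‖ := by ring
      _ ≤ ((L + 1) * (ε / (L + 1))) * ‖h‖ :=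
          mul_le_mul_of_nonneg_right (mul_le_mul (by linarith) hh.le (norm_nonneg _) (by linarith)) (norm_nonneg _)
      _ = ε * ‖h‖ := by rw [mul_div_cancel₀ _ (by linarith : (L + 1 : ℝ) ≠ 0)]
  · -- the Lipschitz letter for the derivative
    refine ContinuousLinearMap.opNorm_le_bound _ (mul_nonneg hL0 (norm_nonneg _)) fun h => ?_
    refine lp.norm_le_of_forall_le (mul_nonneg (mul_nonneg hL0 (norm_nonneg _)) (norm_nonneg _)) fun i => ?_
    rw [sub_apply, lp.coeFn_sub, Pi.sub_apply, hN', hN', ← sub_mul, Real.norm_eq_abs, abs_mul]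
    have h1 : |u' (φ i) - u' (ψ i)| ≤ L * ‖φ - ψ‖ :=
      (hL (φ i) (ψ i)).trans (mul_le_mul_of_nonneg_left (by
        have := abs_apply_le_norm (φ - ψ) i
        rwa [lp.coeFn_sub, Pi.sub_apply] at this) hL0)
    exact mul_le_mul h1 (abs_apply_le_norm h i) (abs_nonneg _) (mul_nonneg hL0 (norm_nonneg _))

/-! ## §3. The transversal (Euler–Lagrange) map `g = R + P ∘ N` and HSCR's smallness letter -/

section Transversal

variable {K : Type*} [NormedAddCommGroup K] [NormedSpace ℝ K]

/-- `g φ := R φ + P (N φ)` has derivative `R + P ∘ N′φ` wherever `N` has derivative `N′φ`. [folklore] -/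
theorem hasFDerivAt_transversal (R P : lp (fun _ : ι => ℝ) ∞ →L[ℝ] K) {N : lp (fun _ : ι => ℝ) ∞ → lp (fun _ : ι => ℝ) ∞}
    {N'φ : lp (fun _ : ι => ℝ) ∞ →L[ℝ] lp (fun _ : ι => ℝ) ∞} {φ : lp (fun _ : ι => ℝ) ∞} (hN : HasFDerivAt N N'φ φ) :
    HasFDerivAt (fun ψ => R ψ + P (N ψ)) (R + P.comp N'φ) φ :=
  R.hasFDerivAt.add (P.hasFDerivAt.comp φ hN)

/-- **HSCR's SMALLNESS LETTER FOR A LOCAL PERTURBATION, RADIUS-FREE**: `‖Dg(φ) − R‖ ≤ ‖P‖·λ` at EVERY `φ` when `‖N′φ‖ ≤ λ`.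
[folklore] -/
theorem norm_fderiv_transversal_sub_le (R P : lp (fun _ : ι => ℝ) ∞ →L[ℝ] K) {N : lp (fun _ : ι => ℝ) ∞ → lp (fun _ : ι => ℝ) ∞}
    {N'φ : lp (fun _ : ι => ℝ) ∞ →L[ℝ] lp (fun _ : ι => ℝ) ∞} {φ : lp (fun _ : ι => ℝ) ∞} (hN : HasFDerivAt N N'φ φ)
    {lam : ℝ} (hlam : ‖N'φ‖ ≤ lam) :
    ‖fderiv ℝ (fun ψ => R ψ + P (N ψ)) φ - R‖ ≤ ‖P‖ * lam := by
  rw [(hasFDerivAt_transversal R P hN).fderiv, add_sub_cancel_left]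
  exact (ContinuousLinearMap.opNorm_comp_le _ _).trans (mul_le_mul_of_nonneg_left hlam (norm_nonneg _))

end Transversal

/-! ## §4. The small-field background configuration in the sup currency -/

section Branch

variable {F K : Type*} [NormedAddCommGroup F] [NormedSpace ℝ F] [NormedAddCommGroup K] [NormedSpace ℝ K]

/-- `ℓ^∞(ι)` is nontrivial for `ι` nonempty (the constant field `1`). [folklore] -/
theorem nontrivial_lp_infty [Nonempty ι] : Nontrivial (lp (fun _ : ι => ℝ) ∞) := by
  obtain ⟨i₀⟩ := ‹Nonempty ι›
  have hmem : Memℓp (fun _ : ι => (1 : ℝ)) ∞ := memℓp_infty ⟨1, by rintro _ ⟨i, rfl⟩; simp⟩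
  refine ⟨⟨⟨fun _ => (1 : ℝ), hmem⟩, 0, fun h => ?_⟩⟩
  have e := congrArg (fun f : lp (fun _ : ι => ℝ) ∞ => f i₀) h
  simp only [lp.coeFn_zero, Pi.zero_apply] at e
  exact one_ne_zero e

/-- **THE SMALL-FIELD BACKGROUND CONFIGURATION OF A PERTURBED QUADRATIC ACTION, IN THE SUP CURRENCY.**  `ι` nonempty; a chart
`T : ℓ^∞ ≃L F × K` reading `(Q, R)` (`T h = (Q h, R h)`) with `‖T⁻¹ y‖ ≤ N‖y‖`; a projection `P : ℓ^∞ →L K` with `‖P‖ ≤ C_P`; a sitewise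
term `u` with `u 0 = 0`, `|u′| ≤ λ`, `u′` `L`-Lipschitz; smallness `c := C_P·λ < N⁻¹`.  Then for every radius `r ≥ 0` there is a branch
`σ : F → ℓ^∞` with `σ 0 = 0` such that for all `w ∈ closedBall 0 ((N⁻¹ − c)·r)`: `σ w ∈ closedBall 0 r`, `Q (σ w) = w` and the
constrained Euler–Lagrange equation `R (σ w) + P (u ∘ σ w) = 0` holds; `σ` is `(N⁻¹ − c)⁻¹`-Lipschitz there; and every `φ ∈ closedBall 0 r`
solving the equation is `σ (Q φ)`.  HSCR `exists_branch_chart` at `δ₀ = 0` with §2–§3's letters. [folklore] -/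
theorem exists_smallField_branch [Nonempty ι] (Q : lp (fun _ : ι => ℝ) ∞ →L[ℝ] F) (R P : lp (fun _ : ι => ℝ) ∞ →L[ℝ] K)
    (T : lp (fun _ : ι => ℝ) ∞ ≃L[ℝ] F × K) (hT : ∀ h, T h = (Q h, R h)) {N c CP lam : ℝ≥0}
    (hN : ∀ y : F × K, ‖T.symm y‖ ≤ N * ‖y‖) (hP : ‖P‖ ≤ CP) (hc : CP * lam ≤ c) (hcN : c < N⁻¹)
    {u u' : ℝ → ℝ} (hu : ∀ t, HasDerivAt u (u' t) t) (hu0 : u 0 = 0) (hlam : ∀ t, |u' t| ≤ lam) {L : ℝ} (hL0 : 0 ≤ L)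
    (hL : ∀ s t, |u' s - u' t| ≤ L * |s - t|) {r : ℝ} (hr : 0 ≤ r) :
    ∃ (Nu : lp (fun _ : ι => ℝ) ∞ → lp (fun _ : ι => ℝ) ∞) (σ : F → lp (fun _ : ι => ℝ) ∞),
      (∀ (φ : lp (fun _ : ι => ℝ) ∞) (i : ι), Nu φ i = u (φ i)) ∧ σ 0 = 0 ∧
      (∀ w ∈ closedBall (0 : F) (((N : ℝ)⁻¹ - c) * r),
        σ w ∈ closedBall 0 r ∧ Q (σ w) = w ∧ R (σ w) + P (Nu (σ w)) = 0) ∧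
      LipschitzOnWith (N⁻¹ - c)⁻¹ σ (closedBall (0 : F) (((N : ℝ)⁻¹ - c) * r)) ∧
      (∀ φ ∈ closedBall (0 : lp (fun _ : ι => ℝ) ∞) r, R φ + P (Nu φ) = 0 → σ (Q φ) = φ) := by
  haveI : Nontrivial (lp (fun _ : ι => ℝ) ∞) := nontrivial_lp_infty
  obtain ⟨Nu, N', hNapp, -, hNderiv, hN'norm, -⟩ :=
    exists_nemytskii (ι := ι) hu lam.coe_nonneg hlam hL0 hL
  -- the transversal map vanishes at the base point `0`
  have hN0 : Nu 0 = 0 := lp.ext (funext fun i => by rw [hNapp, lp.coeFn_zero, Pi.zero_apply, hu0])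
  have hg0 : R 0 + P (Nu 0) = 0 := by rw [hN0, map_zero, map_zero, add_zero]
  -- HSCR's letters on the whole space, in particular on the ball
  have hgd : ∀ x ∈ closedBall (0 : lp (fun _ : ι => ℝ) ∞) r, DifferentiableAt ℝ (fun ψ => R ψ + P (Nu ψ)) x :=
    fun x _ => (hasFDerivAt_transversal R P (hNderiv x)).differentiableAt
  have hgc : ∀ x ∈ closedBall (0 : lp (fun _ : ι => ℝ) ∞) r, ‖fderiv ℝ (fun ψ => R ψ + P (Nu ψ)) x - R‖ ≤ c := fun x _ =>
    (norm_fderiv_transversal_sub_le R P (hNderiv x) (hN'norm x)).trans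
      ((mul_le_mul_of_nonneg_right hP lam.coe_nonneg).trans (by exact_mod_cast hc))
  obtain ⟨σ, hσ0, hσ, hlip, huniq⟩ :=
    HardStepChartRadius.exists_branch_chart Q R T hT (δ₀ := 0) hr hN hcN hgd hgc
  rw [map_zero] at hσ0 hσ hlip
  refine ⟨Nu, σ, hNapp, hσ0, fun w hw => ?_, hlip, fun φ hφ hEL => ?_⟩
  · obtain ⟨h1, h2, h3⟩ := hσ w hw
    refine ⟨h1, h2, ?_⟩
    rw [h3, hg0]
  · exact huniq φ hφ (by rw [hEL, hg0])

end Branch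

/-! ## §5. Toy -/

/-- Toy: the sitewise Taylor letter's shape for `u = id` at `a = 2`, `b = 3` (`u′ = 1`, `L = 0`): the remainder vanishes. -/
example : |((2 : ℝ) + 3) - 2 - 1 * 3| ≤ 0 * 3 ^ 2 := by norm_num

/-! ## §6. (v1.1, APPEND) The background configuration is `C¹` in the coarse field, `‖Dσ‖ ≤ (N⁻¹ − c)⁻¹`, `Q ∘ Dσ = 1` -/

section Deriv

variable {F K : Type*} [NormedAddCommGroup F] [NormedSpace ℝ F] [NormedAddCommGroup K] [NormedSpace ℝ K]

/-- The linearisation `(Q, R + P∘N′φ)` of the transversal system differs from the chart `T = (Q, R)` by at most `‖P‖·λ` when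
`‖N′φ‖ ≤ λ`. [folklore] -/
theorem norm_linearisation_sub_le (Q : lp (fun _ : ι => ℝ) ∞ →L[ℝ] F) (R P : lp (fun _ : ι => ℝ) ∞ →L[ℝ] K)
    (T : lp (fun _ : ι => ℝ) ∞ ≃L[ℝ] F × K) (hT : ∀ h, T h = (Q h, R h))
    {N'φ : lp (fun _ : ι => ℝ) ∞ →L[ℝ] lp (fun _ : ι => ℝ) ∞} {lam : ℝ} (hlam : ‖N'φ‖ ≤ lam) :
    ‖Q.prod (R + P.comp N'φ) - (T : lp (fun _ : ι => ℝ) ∞ →L[ℝ] F × K)‖ ≤ ‖P‖ * lam := by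
  have hTe : (T : lp (fun _ : ι => ℝ) ∞ →L[ℝ] F × K) = Q.prod R := by
    ext h <;> simp [hT h]
  have h1 : Q.prod (R + P.comp N'φ) - Q.prod R = (0 : lp (fun _ : ι => ℝ) ∞ →L[ℝ] F).prod (P.comp N'φ) := by
    ext h <;> simp
  rw [hTe, h1, ContinuousLinearMap.opNorm_prod, Prod.norm_def, norm_zero, max_eq_right (norm_nonneg _)]
  exact (ContinuousLinearMap.opNorm_comp_le _ _).trans (mul_le_mul_of_nonneg_left hlam (norm_nonneg _))

/-- **THE SMALL-FIELD BACKGROUND CONFIGURATION IS `C¹` IN THE COARSE FIELD.**  Under §4's hypotheses, the branch `σ` of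
`exists_smallField_branch` (all of whose letters are re-delivered here) is differentiable at every interior point `‖w‖ < (N⁻¹ − c)·r`
with `‖Dσ(w)‖ ≤ (N⁻¹ − c)⁻¹` and `Q ∘ Dσ(w) = 1` — the background field is a graph over the coarse variable with an operator-norm
letter, in the SUP currency (HSBD BY NAME). [folklore] -/
theorem exists_smallField_branch_deriv [Nonempty ι] (Q : lp (fun _ : ι => ℝ) ∞ →L[ℝ] F) (R P : lp (fun _ : ι => ℝ) ∞ →L[ℝ] K)
    (T : lp (fun _ : ι => ℝ) ∞ ≃L[ℝ] F × K) (hT : ∀ h, T h = (Q h, R h)) {N c CP lam : ℝ≥0}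
    (hN : ∀ y : F × K, ‖T.symm y‖ ≤ N * ‖y‖) (hP : ‖P‖ ≤ CP) (hc : CP * lam ≤ c) (hcN : c < N⁻¹)
    {u u' : ℝ → ℝ} (hu : ∀ t, HasDerivAt u (u' t) t) (hu0 : u 0 = 0) (hlam : ∀ t, |u' t| ≤ lam) {L : ℝ} (hL0 : 0 ≤ L)
    (hL : ∀ s t, |u' s - u' t| ≤ L * |s - t|) {r : ℝ} (hr : 0 ≤ r) :
    ∃ (Nu : lp (fun _ : ι => ℝ) ∞ → lp (fun _ : ι => ℝ) ∞) (σ : F → lp (fun _ : ι => ℝ) ∞),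
      (∀ (φ : lp (fun _ : ι => ℝ) ∞) (i : ι), Nu φ i = u (φ i)) ∧ σ 0 = 0 ∧
      (∀ w ∈ closedBall (0 : F) (((N : ℝ)⁻¹ - c) * r),
        σ w ∈ closedBall 0 r ∧ Q (σ w) = w ∧ R (σ w) + P (Nu (σ w)) = 0) ∧
      LipschitzOnWith (N⁻¹ - c)⁻¹ σ (closedBall (0 : F) (((N : ℝ)⁻¹ - c) * r)) ∧
      (∀ φ ∈ closedBall (0 : lp (fun _ : ι => ℝ) ∞) r, R φ + P (Nu φ) = 0 → σ (Q φ) = φ) ∧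
      (∀ w ∈ ball (0 : F) (((N : ℝ)⁻¹ - c) * r),
        DifferentiableAt ℝ σ w ∧ ‖fderiv ℝ σ w‖ ≤ ((N : ℝ)⁻¹ - c)⁻¹ ∧ Q.comp (fderiv ℝ σ w) = ContinuousLinearMap.id ℝ F) := by
  haveI : Nontrivial (lp (fun _ : ι => ℝ) ∞) := nontrivial_lp_infty
  obtain ⟨Nu, N', hNapp, -, hNderiv, hN'norm, -⟩ :=
    exists_nemytskii (ι := ι) hu lam.coe_nonneg hlam hL0 hL
  have hN0 : Nu 0 = 0 := lp.ext (funext fun i => by rw [hNapp, lp.coeFn_zero, Pi.zero_apply, hu0])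
  have hg0 : R 0 + P (Nu 0) = 0 := by rw [hN0, map_zero, map_zero, add_zero]
  have hc' : ∀ x : lp (fun _ : ι => ℝ) ∞, ‖P‖ * ‖N' x‖ ≤ c := fun x =>
    (mul_le_mul hP (hN'norm x) (norm_nonneg _) CP.coe_nonneg).trans (by exact_mod_cast hc)
  have hgd : ∀ x ∈ closedBall (0 : lp (fun _ : ι => ℝ) ∞) r, DifferentiableAt ℝ (fun ψ => R ψ + P (Nu ψ)) x :=
    fun x _ => (hasFDerivAt_transversal R P (hNderiv x)).differentiableAt
  have hgc : ∀ x ∈ closedBall (0 : lp (fun _ : ι => ℝ) ∞) r, ‖fderiv ℝ (fun ψ => R ψ + P (Nu ψ)) x - R‖ ≤ c := fun x _ =>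
    (norm_fderiv_transversal_sub_le R P (hNderiv x) le_rfl).trans (hc' x)
  obtain ⟨σ, hσ0, hσ, hlip, huniq⟩ :=
    HardStepChartRadius.exists_branch_chart Q R T hT (δ₀ := 0) hr hN hcN hgd hgc
  rw [map_zero] at hσ0 hσ hlip
  -- HSBD's letters for `Φ = (Q, R + P∘Nu)`, `Φ′ = (Q, R + P∘N′)`
  have hΦd : ∀ x ∈ closedBall (0 : lp (fun _ : ι => ℝ) ∞) r,
      HasFDerivAt (fun ψ => (Q ψ, R ψ + P (Nu ψ))) (Q.prod (R + P.comp (N' x))) x := fun x _ =>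
    Q.hasFDerivAt.prodMk (hasFDerivAt_transversal R P (hNderiv x))
  have hΦc : ∀ x ∈ closedBall (0 : lp (fun _ : ι => ℝ) ∞) r,
      ‖Q.prod (R + P.comp (N' x)) - (T : lp (fun _ : ι => ℝ) ∞ →L[ℝ] F × K)‖ ≤ c := fun x _ =>
    (norm_linearisation_sub_le Q R P T hT le_rfl).trans (hc' x)
  have hσ' : ∀ w ∈ closedBall (0 : F) (((N : ℝ)⁻¹ - c) * r), σ w ∈ closedBall 0 r ∧
      ((fun ψ => (Q ψ, R ψ + P (Nu ψ))) (σ w)).1 = w ∧ ((fun ψ => (Q ψ, R ψ + P (Nu ψ))) (σ w)).2 = 0 := fun w hw => by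
    obtain ⟨h1, h2, h3⟩ := hσ w hw
    refine ⟨h1, h2, ?_⟩
    show R (σ w) + P (Nu (σ w)) = 0
    rw [h3, hg0]
  refine ⟨Nu, σ, hNapp, hσ0, fun w hw => ?_, hlip, fun φ hφ hEL => huniq φ hφ (by rw [hEL, hg0]), fun w hw => ?_⟩
  · obtain ⟨h1, h2, h3⟩ := hσ w hw
    exact ⟨h1, h2, by rw [h3, hg0]⟩
  · obtain ⟨A, hAeq, -, hd, hn⟩ := HardStepBranchDeriv.hasFDerivAt_sliceBranch_of_chart T hN hcN hΦd hΦc hσ'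
      hlip.continuousOn hw
    have hA : ∀ h, A h = (Q h, (R + P.comp (N' (σ w))) h) := fun h => by
      rw [← ContinuousLinearEquiv.coe_coe, hAeq, ContinuousLinearMap.prod_apply]
    refine ⟨hd.differentiableAt, by rwa [hd.fderiv], ?_⟩
    rw [hd.fderiv]
    exact HardStepBranchDeriv.fst_comp_symm_comp_inl A Q _ hA

end Deriv

end Summit.QuantumFields.BalabanUV.T4Continuum.NE7b.LocalNemytskiiSup

end
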